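import Summits.BirchSwinnertonDyer.BirchSwinnertonDyer.Theorems.GoldfeldAllTwistsTwoConverseTwinNonSharpSelmerDualThreeFive
import Summits.BirchSwinnertonDyer.BirchSwinnertonDyer.Theorems.GoldfeldAllTwistsTwoConverseTwinNonSharpRankLeThreeThreeOne
import Summits.BirchSwinnertonDyer.BirchSwinnertonDyer.Theorems.GoldfeldAllTwistsTwoConverseTwinNonSharpRankLeThreeEightOne
import Summits.BirchSwinnertonDyer.BirchSwinnertonDyer.Theorems.GoldfeldAllTwistsTwoConverseTwinAdditiveTwoPrimesTwistDescent
import Summits.BirchSwinnertonDyer.BirchSwinnertonDyer.Theorems.GoldfeldAllTwistsTwoConverseTwinAdditiveTwoPrimesTwistDescentSharpPlusPFive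
import HarnessLib

set_option linter.dupNamespace false -- namespace `…BirchSwinnertonDyer.BirchSwinnertonDyer…` is the cell's (D-0017 nested layout)
set_option autoImplicit false

/-!
# OBJECT 10 capstone: **`rank W(ℚ) ≤ 3` for EVERY `W ≅ 49a1^{(−2qp)}` with the binders of THEOREM A⁗ (R p725669) minus `hcell`** — first descent on the
# last stratum `q ≡ 3 (8)`, `p ≡ 5 (8)` (cell C2: `≤ 3` for all, `= 3` at `(19, 37)`), then the assembly of the four strata; on each of the four `(4,8)`
# cells C1, C2, b31+, b71+ the bound `3` is ATTAINED (OBJECT 9)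

Cell `bsd-goldfeld`, seat `bsd-goldfeld-s1p-c3x` (gen 21); planner RULINGS (cdxxxviii)/(cdxli), OPTIONAL OBJECT 10 «FIRST-DESCENT UPPER BOUNDS ON THE
(4,8) CELLS», TRANCHE C′ (C2), file 2 of 2 = the closing file of OBJECT 10. `--supports stmt-BirchSwinnertonDyer-20044` as a HELPER (rank axis).
FACT-FREE: no print binder, no definition, no `sorry`; Theses-free.

§1 **Stratum `q ≡ 3 (8)`, `p ≡ 5 (8)`**: `#S ≤ 4` (`card_twoIsogenySelmerGroup_twoPrimesTwist_le_four_threeMod`, `…TwinNonSharpRankLeThreeThreeOne`, valid for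
every `p ≡ 1 (4)`) and `#S′ ≤ 8` (file 1, `…TwinNonSharpSelmerDualThreeFive`) ⇒ `rank E(ℚ) ≤ 3` for `E = [0, −42qp, 0, 448q²p², 0]`
(`twoIsogeny_mordellWeilRank_add_two_le_holds`) ⇒ `rank W(ℚ) ≤ 3` for every model `W` (the lane's transport).
§2 **Cell C2** (binders = the capstone's LETTER FOR LETTER minus `hcell`, plus the C2 clause exactly as in OBJECT 9's `not_forall_mordellWeilRank_eq_one_cellC2`):
`rank ≤ 3` for every `W`; **`rank W(ℚ) = 3` EXACTLY for every `W ≅ 49a1^{(−1406)}`** (`(q,p) = (19,37)`; `3 ≤` = OBJECT 9's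
`three_le_mordellWeilRank_twoPrimesTwist_19_37`); «`≤ 3` for all ∧ `= 3` attained».
§3 **ASSEMBLY — THE SIXTEEN CELLS AT ONCE.** With EXACTLY the binders of `analyticRank_eq_one_twoPrimesTwist_sharpLocus_of_print` minus `hcell` (`q > 3` prime,
`q ≡ 3 (mod 4)`, `(q/7) = −1`; `p` prime, `p ≡ 1 (mod 4)`, `(−7/p) = +1`; `C • W = cm7^{(−2qp)}`): **`rank W(ℚ) ≤ 3`, UNCONDITIONALLY** — by cases on
`(q mod 8, p mod 8)`: `(7,1)` `…_eightOne` (OBJECT 10-A), `(3,1)` `…_threeOne` (10-B′), `(3,5)` §1 (10-C′), and `(7,5)`, where every cell is first-descent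
SHARP and the landed descents already give `rank ≤ 1` (T3-D `rank_le_one_and_sha_two_twoPrimesTwist` at `(p/q) = −1` with `q ≡ 7 (8)`; Fβ⁺-4a
`rank_le_one_and_sha_two_twoPrimesTwist_plusPFive` at `(p/q) = +1`, type-free). The same with the capstone's complement clause (the non-sharp locus
C1 ∪ C2 ∪ b31+ ∪ b71+, as in OBJECT 9's `not_forall_mordellWeilRank_eq_one_nonSharpLocus`), and the four exact witnesses `rank = 3` at
`−2qp ∈ {−12806, −1406, −53654, −120046}` gathered in one statement.
So the tree now holds the COMPLETE first-descent picture of the family: on the twelve sharp cells `rank ≤ 1` unconditionally and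
`r_an = rank = 1 ∧ Ш finite` modulo named print (capstones R p725669 / F p725691); on the four `(4,8)` cells `rank ≤ 3` unconditionally, cell-uniform
`rank = 1` REFUTED, and `rank = 3` ATTAINED — all by name.
HONEST FRAMING: the textbook first-descent bound (Silverman X.4.7 / Silverman–Tate §3.6) made kernel for this family, nothing more; first descent only;
NO width change (C1/C2 = BARRIER cells, b31+/b71+ = second descent / `rk₄ ≥ 1`, σ(ℓ) = +1 — all stay director width; not a road to rank one); items
19349 / 19350 / 20044 / 19140 neither closed nor advanced; `closes` untouched; the two-primes family has twist-density ZERO; BSD is not proved by any of this.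

References: [SilvermanAEC2009] Prop. X.4.7, Prop. X.4.9, Example X.4.10, III.3.1(b); [SilvermanTate2015] §3.6.
-/

noncomputable section

open scoped Classical

open WeierstrassCurve Literature.NumberTheory.EllipticCurves

namespace Summit.BirchSwinnertonDyer.BirchSwinnertonDyer.Theorems.GoldfeldGoodTwists

/-! ## §1 The stratum `q ≡ 3 (8)`, `p ≡ 5 (8)`: `rank ≤ 3` -/

section StratumThreeFive
variable {q p : ℕ} [Fact q.Prime] [Fact p.Prime]

/-- **`rank E(ℚ) ≤ 3`** for the two-torsion model `E = [0, −42qp, 0, 448q²p², 0]` of `49a1^{(−2qp)}` on the stratum `q ≡ 3 (8)`, `(q/7) = −1`,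
`p ≡ 5 (8)`, `(−7/p) = +1`: `#S ≤ 4`, `#S′ ≤ 8`, `rank + 2 ≤ dim₂ S + dim₂ S′`. UNCONDITIONAL, fact-free. [cite: SilvermanTate2015, §3.6 (2^r = #α(Γ)·#ᾱ(Γ̄)/4)]
[cite: SilvermanAEC2009, Prop. X.4.7] -/
theorem mordellWeilRank_le_three_twoTorsionModel_twoPrimesTwist_threeFive (hq8 : q % 8 = 3) (hq7 : jacobiSym q 7 = -1) (hp8 : p % 8 = 5)
    (hp7 : legendreSym p (-7) = 1) :
    (⟨0, ((-42 * ((q : ℤ) * p) : ℤ) : ℚ), 0, ((448 * ((q : ℤ) * p) ^ 2 : ℤ) : ℚ), 0⟩ : WeierstrassCurve ℚ).mordellWeilRank ≤ 3 := by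
  have hq : q.Prime := Fact.out
  have hp : p.Prime := Fact.out
  have hq0 : (q : ℤ) ≠ 0 := by exact_mod_cast hq.ne_zero
  have hp0 : (p : ℤ) ≠ 0 := by exact_mod_cast hp.ne_zero
  have hab : (448 * ((q : ℤ) * p) ^ 2) * ((-42 * ((q : ℤ) * p)) ^ 2 - 4 * (448 * ((q : ℤ) * p) ^ 2)) ≠ 0 := by
    rw [show (-42 * ((q : ℤ) * p)) ^ 2 - 4 * (448 * ((q : ℤ) * p) ^ 2) = -28 * ((q : ℤ) * p) ^ 2 by ring]
    exact mul_ne_zero (by positivity) (mul_ne_zero (by norm_num) (pow_ne_zero 2 (mul_ne_zero hq0 hp0)))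
  have h := twoIsogeny_mordellWeilRank_add_two_le_holds (-42 * ((q : ℤ) * p)) (448 * ((q : ℤ) * p) ^ 2) hab
  have hS := card_twoIsogenySelmerGroup_twoPrimesTwist_le_four_threeMod hq8 hq7 (by omega : p % 4 = 1)
  have hS' := card_twoIsogenySelmerGroup'_twoPrimesTwist_le_eight_threeFive hq8 hq7 hp8 hp7
  have e1 := two_pow_twoIsogenySelmerRank_eq_card hab
  have e2 := two_pow_twoIsogenySelmerRank'_eq_card hab
  have hsr : twoIsogenySelmerRank (-42 * ((q : ℤ) * p)) (448 * ((q : ℤ) * p) ^ 2) ≤ 2 := by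
    by_contra hc
    have h3 : 2 ^ 3 ≤ 2 ^ twoIsogenySelmerRank (-42 * ((q : ℤ) * p)) (448 * ((q : ℤ) * p) ^ 2) := Nat.pow_le_pow_right (by norm_num) (by omega)
    omega
  have hsr' : twoIsogenySelmerRank' (-42 * ((q : ℤ) * p)) (448 * ((q : ℤ) * p) ^ 2) ≤ 3 := by
    by_contra hc
    have h4 : 2 ^ 4 ≤ 2 ^ twoIsogenySelmerRank' (-42 * ((q : ℤ) * p)) (448 * ((q : ℤ) * p) ^ 2) := Nat.pow_le_pow_right (by norm_num) (by omega)
    omega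
  omega

/-- **`rank W(ℚ) ≤ 3` for EVERY model `W` of `49a1^{(−2qp)}` on the stratum** `q ≡ 3 (8)`, `(q/7) = −1`, `p ≡ 5 (8)`, `(−7/p) = +1` (cells (β,−), a35+,
b35+ — where the landed sharp descents give `≤ 1` — and the `(4,8)` cell C2), in the capstone's spelling `C • W = cm7.quadraticTwist (−(2·q·p))`.
[cite: SilvermanAEC2009, III.3.1(b) and VIII.6] [cite: SilvermanTate2015, §3.6] -/
theorem mordellWeilRank_le_three_twoPrimesTwist_threeFive (hq8 : q % 8 = 3) (hq7 : jacobiSym q 7 = -1) (hp8 : p % 8 = 5)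
    (hp7 : legendreSym p (-7) = 1) (W : WeierstrassCurve ℚ) [W.IsElliptic] (C : VariableChange ℚ)
    (hC : C • W = cm7.quadraticTwist (-(2 * (q : ℚ) * p))) : W.mordellWeilRank ≤ 3 := by
  have hC' : C • W = cm7.quadraticTwist (((-2 * ((q : ℤ) * p) : ℤ)) : ℚ) := by
    rw [hC]; congr 1; push_cast; ring
  have hE := (smul_eq_twoTorsionModel_of_smul_eq_quadraticTwist (-2 * ((q : ℤ) * p)) W C hC').trans
    (show (⟨0, ((21 * (-2 * ((q : ℤ) * p)) : ℤ) : ℚ), 0, ((112 * (-2 * ((q : ℤ) * p)) ^ 2 : ℤ) : ℚ), 0⟩ : WeierstrassCurve ℚ) =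
        ⟨0, ((-42 * ((q : ℤ) * p) : ℤ) : ℚ), 0, ((448 * ((q : ℤ) * p) ^ 2 : ℤ) : ℚ), 0⟩ by
      ext <;> push_cast <;> ring)
  have hrk := mordellWeilRank_variableChange_holds W
    ((⟨(Units.mk0 (2 : ℚ) two_ne_zero)⁻¹, 2 * (((-2 * ((q : ℤ) * p) : ℤ)) : ℚ), 0, 0⟩ : VariableChange ℚ) * C)
  unfold mordellWeilRank_variableChange at hrk
  rw [← hrk, hE]
  exact mordellWeilRank_le_three_twoTorsionModel_twoPrimesTwist_threeFive hq8 hq7 hp8 hp7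

end StratumThreeFive

/-! ## §2 Cell C2: `rank ≤ 3` for all, `= 3` attained -/

section CellC2

/-- **Cell C2: `rank W(ℚ) ≤ 3` for every `W ≅ 49a1^{(−2qp)}`** — binders = the capstone R p725669's LETTER FOR LETTER minus `hcell`, plus the C2 clause
`(p/q) = −1 ∧ q ≡ 3 (8) ∧ α ∧ p ≡ 5 (8)` exactly as in OBJECT 9's `not_forall_mordellWeilRank_eq_one_cellC2` (where «`rank W(ℚ) = 1` for every such `W`» is
refuted). [cite: SilvermanTate2015, §3.6] -/
theorem mordellWeilRank_le_three_twoPrimesTwist_cellC2 {q p : ℕ} (hq : q.Prime) (_h3 : 3 < q) (_hq4 : q % 4 = 3) (hq7 : jacobiSym q 7 = -1)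
    [Fact p.Prime] (_hp4 : p % 4 = 1) (hp7 : legendreSym p (-7) = 1)
    (hcell : jacobiSym (p : ℤ) q = -1 ∧ q % 8 = 3 ∧ (¬ ∃ x : ZMod p, x ^ 4 = -7) ∧ p % 8 = 5)
    (W : WeierstrassCurve ℚ) [W.IsElliptic] (C : VariableChange ℚ) (hC : C • W = cm7.quadraticTwist (-(2 * (q : ℚ) * p))) :
    W.mordellWeilRank ≤ 3 := by
  haveI : Fact q.Prime := ⟨hq⟩
  exact mordellWeilRank_le_three_twoPrimesTwist_threeFive hcell.2.1 hq7 hcell.2.2.2 hp7 W C hC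

/-- **`rank W(ℚ) = 3` EXACTLY for every model `W` of `49a1^{(−2·19·37)} = 49a1^{(−1406)}`** (cell C2): `≤ 3` by §1, `3 ≤` by OBJECT 9's kernel
certificate `three_le_mordellWeilRank_twoPrimesTwist_19_37`. UNCONDITIONAL, fact-free. [cite: SilvermanTate2015, §3.6] -/
theorem mordellWeilRank_eq_three_twoPrimesTwist_19_37 (W : WeierstrassCurve ℚ) [W.IsElliptic] (C : VariableChange ℚ)
    (hC : C • W = cm7.quadraticTwist (-(2 * ((19 : ℕ) : ℚ) * ((37 : ℕ) : ℚ)))) : W.mordellWeilRank = 3 := by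
  obtain ⟨hq, hp, hq8, hq7, hp8, hp7, -, -⟩ := cellC2_19_37
  haveI : Fact (Nat.Prime 19) := ⟨hq⟩
  haveI : Fact (Nat.Prime 37) := ⟨hp⟩
  refine le_antisymm ?_ (three_le_mordellWeilRank_twoPrimesTwist_19_37 W C hC)
  exact mordellWeilRank_le_three_twoPrimesTwist_threeFive (q := 19) (p := 37) hq8 hq7 hp8
    (by rw [legendreSym_neg_seven_eq_jacobiSym (by norm_num)]; exact hp7) W C hC

/-- **C2 summary: `rank ≤ 3` for every `W` on the cell, and a member (`(q,p) = (19,37)`) with `rank = 3`.** [cite: SilvermanTate2015, §3.6] -/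
theorem mordellWeilRank_le_three_and_attained_cellC2 :
    (∀ {q p : ℕ} (_ : q.Prime) (_ : 3 < q) (_ : q % 4 = 3) (_ : jacobiSym q 7 = -1) [Fact p.Prime] (_ : p % 4 = 1)
        (_ : legendreSym p (-7) = 1) (_ : jacobiSym (p : ℤ) q = -1 ∧ q % 8 = 3 ∧ (¬ ∃ x : ZMod p, x ^ 4 = -7) ∧ p % 8 = 5)
        (W : WeierstrassCurve ℚ) [W.IsElliptic] (C : VariableChange ℚ),
        C • W = cm7.quadraticTwist (-(2 * (q : ℚ) * p)) → W.mordellWeilRank ≤ 3) ∧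
    (∃ (q p : ℕ) (_ : q.Prime) (_ : 3 < q) (_ : q % 4 = 3) (_ : jacobiSym q 7 = -1) (_ : Fact p.Prime) (_ : p % 4 = 1)
        (_ : legendreSym p (-7) = 1) (_ : jacobiSym (p : ℤ) q = -1 ∧ q % 8 = 3 ∧ (¬ ∃ x : ZMod p, x ^ 4 = -7) ∧ p % 8 = 5)
        (W : WeierstrassCurve ℚ) (_ : W.IsElliptic) (C : VariableChange ℚ),
        C • W = cm7.quadraticTwist (-(2 * (q : ℚ) * p)) ∧ W.mordellWeilRank = 3) := by
  refine ⟨fun hq h3 hq4 hq7 _ hp4 hp7 hcell W _ C hC ↦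
    mordellWeilRank_le_three_twoPrimesTwist_cellC2 hq h3 hq4 hq7 hp4 hp7 hcell W C hC, ?_⟩
  obtain ⟨hq, hp, hq8, hq7, hp8, hp7, hpq, htyp⟩ := cellC2_19_37
  haveI : Fact (Nat.Prime 37) := ⟨hp⟩
  haveI := isElliptic_quadraticTwist (W := cm7) (d := -(2 * ((19 : ℕ) : ℚ) * ((37 : ℕ) : ℚ))) (by norm_num)
  exact ⟨19, 37, hq, by norm_num, by norm_num, hq7, inferInstance, by norm_num,
    by rw [legendreSym_neg_seven_eq_jacobiSym (by norm_num)]; exact hp7, ⟨by exact_mod_cast hpq, hq8, htyp, hp8⟩,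
    cm7.quadraticTwist (-(2 * ((19 : ℕ) : ℚ) * ((37 : ℕ) : ℚ))), inferInstance, 1, one_smul _ _,
    mordellWeilRank_eq_three_twoPrimesTwist_19_37 _ 1 (one_smul _ _)⟩

end CellC2

/-! ## §3 Assembly: `rank ≤ 3` with the capstone's binders minus `hcell`; the non-sharp locus; the four exact witnesses -/

section Assembly

/-- **`rank W(ℚ) ≤ 3` for EVERY `W ≅ 49a1^{(−2qp)}` with EXACTLY the binders of THEOREM A⁗ (`analyticRank_eq_one_twoPrimesTwist_sharpLocus_of_print`,
R p725669) minus `hcell`** — `q > 3` prime, `q ≡ 3 (mod 4)`, `(q/7) = −1`; `p` prime, `p ≡ 1 (mod 4)`, `(−7/p) = +1` — UNCONDITIONALLY and fact-free: by cases on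
`(q mod 8, p mod 8)` onto the three non-sharp strata of OBJECT 10 (`…_eightOne`, `…_threeOne`, `…_threeFive`) and, on `(7, 5)`, onto the landed SHARP
descents (`rank ≤ 1`: T3-D `rank_le_one_and_sha_two_twoPrimesTwist` at `(p/q) = −1`, Fβ⁺-4a `rank_le_one_and_sha_two_twoPrimesTwist_plusPFive` at
`(p/q) = +1`, both type-free at `q ≡ 7 (8)`). Juxtapose with OBJECT 9's `not_forall_mordellWeilRank_eq_one_twoPrimesTwist` (same binders: «`rank = 1` for all»
is FALSE) and with the capstone itself (`rank = 1` on the twelve sharp cells, modulo named print). [cite: SilvermanAEC2009, Prop. X.4.7] [cite: SilvermanTate2015, §3.6] -/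
theorem mordellWeilRank_le_three_twoPrimesTwist {q p : ℕ} (hq : q.Prime) (_h3 : 3 < q) (hq4 : q % 4 = 3) (hq7 : jacobiSym q 7 = -1)
    [Fact p.Prime] (hp4 : p % 4 = 1) (hp7 : legendreSym p (-7) = 1)
    (W : WeierstrassCurve ℚ) [W.IsElliptic] (C : VariableChange ℚ) (hC : C • W = cm7.quadraticTwist (-(2 * (q : ℚ) * p))) :
    W.mordellWeilRank ≤ 3 := by
  haveI : Fact q.Prime := ⟨hq⟩
  have hp : p.Prime := Fact.out
  obtain hq8 | hq8 : q % 8 = 3 ∨ q % 8 = 7 := by omega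
  · obtain hp8 | hp8 : p % 8 = 1 ∨ p % 8 = 5 := by omega
    · exact mordellWeilRank_le_three_twoPrimesTwist_threeOne hq8 hq7 hp8 hp7 W C hC
    · exact mordellWeilRank_le_three_twoPrimesTwist_threeFive hq8 hq7 hp8 hp7 W C hC
  · obtain hp8 | hp8 : p % 8 = 1 ∨ p % 8 = 5 := by omega
    · exact mordellWeilRank_le_three_twoPrimesTwist_eightOne hq8 hq7 hp8 hp7 W C hC
    · -- `(q, p) ≡ (7, 5) (mod 8)`: every cell is first-descent sharp; the landed descents give `rank ≤ 1`
      have hC' : C • W = cm7.quadraticTwist (((-2 * ((q : ℤ) * p) : ℤ)) : ℚ) := by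
        rw [hC]; congr 1; push_cast; ring
      have hqp : q ≠ p := by rintro rfl; omega
      have hgcd : (p : ℤ).gcd q = 1 := by
        rw [Int.gcd_natCast_natCast]
        exact (Nat.coprime_primes hp hq).mpr (Ne.symm hqp)
      rcases jacobiSym.eq_one_or_neg_one hgcd with hj | hj
      · exact (rank_le_one_and_sha_two_twoPrimesTwist_plusPFive hq8 hq7 hp8 hp7 hj W C hC').1.trans (by norm_num)
      · exact (rank_le_one_and_sha_two_twoPrimesTwist hq4 hq7 hp8 hp7 hj (Or.inl hq8) W C hC').1.trans (by norm_num)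

/-- **The NON-SHARP LOCUS as the capstone spells it** (binders + the complement clause of its §0 `twoPrimes_sharpLocus_or_nonSharp`, exactly as in OBJECT 9's
`not_forall_mordellWeilRank_eq_one_nonSharpLocus`, where «`rank = 1` for every such `W`» is refuted): **`rank W(ℚ) ≤ 3` for every such `W`**.
[cite: SilvermanTate2015, §3.6] -/
theorem mordellWeilRank_le_three_twoPrimesTwist_nonSharpLocus {q p : ℕ} (hq : q.Prime) (h3 : 3 < q) (hq4 : q % 4 = 3) (hq7 : jacobiSym q 7 = -1)
    [Fact p.Prime] (hp4 : p % 4 = 1) (hp7 : legendreSym p (-7) = 1)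
    (_hcell : (jacobiSym (p : ℤ) q = -1 ∧ q % 8 = 3 ∧ ¬ ∃ x : ZMod p, x ^ 4 = -7) ∨
      (jacobiSym (p : ℤ) q = 1 ∧ (∃ x : ZMod p, x ^ 4 = -7) ∧ p % 8 = 1))
    (W : WeierstrassCurve ℚ) [W.IsElliptic] (C : VariableChange ℚ) (hC : C • W = cm7.quadraticTwist (-(2 * (q : ℚ) * p))) :
    W.mordellWeilRank ≤ 3 :=
  mordellWeilRank_le_three_twoPrimesTwist hq h3 hq4 hq7 hp4 hp7 W C hC

/-- **The bound `3` is ATTAINED on each of the four `(4,8)` cells — the exact ranks of the four witnesses in one statement**: `rank W(ℚ) = 3` for every model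
`W` of `49a1^{(−12806)}` (C1), `49a1^{(−1406)}` (C2), `49a1^{(−53654)}` (b31+), `49a1^{(−120046)}` (b71+) (`≤` = OBJECT 10's first descent, `≥` = OBJECT 9's
explicit points). UNCONDITIONAL, fact-free. [cite: SilvermanTate2015, §3.6] -/
theorem mordellWeilRank_eq_three_nonSharp_witnesses :
    (∀ (W : WeierstrassCurve ℚ) [W.IsElliptic] (C : VariableChange ℚ),
        C • W = cm7.quadraticTwist (-(2 * ((19 : ℕ) : ℚ) * ((337 : ℕ) : ℚ))) → W.mordellWeilRank = 3) ∧
    (∀ (W : WeierstrassCurve ℚ) [W.IsElliptic] (C : VariableChange ℚ),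
        C • W = cm7.quadraticTwist (-(2 * ((19 : ℕ) : ℚ) * ((37 : ℕ) : ℚ))) → W.mordellWeilRank = 3) ∧
    (∀ (W : WeierstrassCurve ℚ) [W.IsElliptic] (C : VariableChange ℚ),
        C • W = cm7.quadraticTwist (-(2 * ((139 : ℕ) : ℚ) * ((193 : ℕ) : ℚ))) → W.mordellWeilRank = 3) ∧
    (∀ (W : WeierstrassCurve ℚ) [W.IsElliptic] (C : VariableChange ℚ),
        C • W = cm7.quadraticTwist (-(2 * ((311 : ℕ) : ℚ) * ((193 : ℕ) : ℚ))) → W.mordellWeilRank = 3) :=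
  ⟨fun W _ C hC ↦ mordellWeilRank_eq_three_twoPrimesTwist_19_337 W C hC,
   fun W _ C hC ↦ mordellWeilRank_eq_three_twoPrimesTwist_19_37 W C hC,
   fun W _ C hC ↦ mordellWeilRank_eq_three_twoPrimesTwist_139_193 W C hC,
   fun W _ C hC ↦ mordellWeilRank_eq_three_twoPrimesTwist_311_193 W C hC⟩

end Assembly

end Summit.BirchSwinnertonDyer.BirchSwinnertonDyer.Theorems.GoldfeldGoodTwists

end
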